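import Literature.AlgebraicGeometry.AbelianSchemes.TorsionSectionPointDatum
import Literature.AlgebraicGeometry.AbelianSchemes.TorsionSectionPairingBaseChange
import Literature.AlgebraicGeometry.AbelianSchemes.FibreWeilPairingDiscrepancy
import Literature.GroupTheory.FiniteAbelian.RootsOfUnityEvaluationTransport
import Literature.AlgebraicGeometry.Morphisms.RootOfUnityRigidConnected
import HarnessLib

/-!
# The Gram data of the `M`-torsion sections is the same at all geometric points of a connected base
# ([MumfordAV1970] §20: the `e_n`-pairing over a base is a section of `μ_n`, rigid on a connected base)

Layer `Literature/AlgebraicGeometry/AbelianSchemes`, namespace `Literature.AlgebraicGeometry.AbelianSchemes.AbelianSchemeOver`.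
ONE plumbing `def` (`pointUnitIso`, `q^*𝒪 ≅ 𝒪`) AND THEOREMS (no named fact, no instance, no notation, no `sorry`).
Sequel of ★ `TorsionSectionTranslationAction` (W3-core FILE 1) and ★-to-be `TorsionSectionPointDatum` (FILE 2a).

For an abelian scheme `A/S` over a REDUCED locally Noetherian base with a rigidified dual pair `D = (Â, 𝒫)` and a homomorphism
`λ : A → Â`, a base change `f : T ⟶ S` with `T` connected, locally Noetherian and `M` invertible on `T`, the `M`-torsion sections
`A_T[M](T)` act on `A_T` by translations over `[M]` (★ `translationActionMulN`) and on the line bundles `L_{c_b} = (1 × c_b)^*𝒫`,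
`c_b = λ ∘ pr_A ∘ b` (★ W1b `TorsionSectionPairing`: pairing units `u_b(a) ∈ μ_M(Γ(T, 𝒪_T))`).

* §1 **`weilPairingLevel_baseChangeTorsionPt_eq_inv`** — at a geometric point `t` of `T`, for a witness `Θ` of `λ` on the fibre
  `A_{t ≫ f}` (`IsLambdaOfAt`), `ē^Θ_M(a(t), b(t)) = (u_b(a)(t))⁻¹`: ★ W1c `discrepancy_baseChange` along the square
  `A_{t ≫ f} → A_T` (★ FILE 1/2a: `baseChangeRestrict`, `pointTranslationAction`, `pointLineBundleIso`, `pointUnitIso`) feeds ★ W3a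
  `weilPairingLevel_eq_inv_of_poincare_discrepancy` at `s := t ≫ f`;
* §2 **`exists_rootsOfUnity_transport_weilPairingLevel`** (the (h9-S) W3-core head, signature frozen 2026-08-30 05:28Z for the
  consumer ★-to-be `SymplecticLiftableOfOnePoint`) — for two geometric points `t₀, t₁` of `T` there is `χ : Ω₀ → Ω₁` carrying
  primitive `M`-th roots to primitive `M`-th roots, powers to powers, and `ē^{Θ₀}_M(a(t₀), b(t₀))` to `ē^{Θ₁}_M(a(t₁), b(t₁))` for all
  `a, b ∈ A_T[M](T)` (§1 at both points, rigidity of `μ_M(Γ(T, 𝒪_T))` on the connected `T` ★ `RootOfUnityRigidConnected`, and ★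
  `exists_rootsOfUnity_transport`).

Cell hodgecm-mathlib (D-0151), F-DAG (h9) symplectic half (F-6 (V′) «symplectic liftability from ONE geometric point»), W3-core
FILE 2b (lead B-p11 (g16); consumer B-p13 (g19) FILE 3). Count-neutral; HC_CM is proved only modulo the 7 printed citations
until rung 0 closes — nothing here is about HC.

## References
* [MumfordAV1970] D. Mumford, *Abelian Varieties* (1970), §20 (pp. 183–185), §23 (p. 228).
* [Milne1986AbelianVarieties] J. S. Milne, *Abelian Varieties* (1986), §16 (p. 132).
* [Hartshorne1977] R. Hartshorne, *Algebraic Geometry*, II §5 (p. 110).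
* [SGA1] A. Grothendieck, SGA 1, Exp. I Cor. 5.4 (rigidity of sections of étale schemes).
-/

set_option autoImplicit false

noncomputable section

-- `Over`-morphism components and the transported group structures are compared across `def`s (as in the tree's W1 files).
set_option backward.isDefEq.respectTransparency false

universe u

open CategoryTheory CategoryTheory.Limits AlgebraicGeometry MonoidalCategory CartesianMonoidalCategory
open scoped MonObj

namespace Literature.AlgebraicGeometry.AbelianSchemes.AbelianSchemeOver

open Literature.AlgebraicGeometry.RelativeSpec Literature.AlgebraicGeometry.Motives
  Literature.AlgebraicGeometry.AbelianVarieties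

variable {S : Scheme.{u}} (A : AbelianSchemeOver S) (M : ℕ)

/-! ## §1 `q^*𝒪 ≅ 𝒪` and the fibre evaluation of the pairing units -/

section GramUnits

open Literature.AlgebraicGeometry.Modules Literature.AlgebraicGeometry.RelativeSpec.ActionOver
  Literature.AlgebraicGeometry.HodgeTheory Literature.AlgebraicGeometry.Morphisms

variable {T : Scheme.{u}} (D : A.DualPair) (lam : A.X ⟶ D.hat.X) (f : T ⟶ S)

/-- **`q^* 𝒪_{A_T} ≅ 𝒪_{A_{t ≫ f}}`** (the functor `U ↦ q⁻¹U` on opens is final) — the `j₀` of ★ `discrepancy_baseChange`.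
[cite: Hartshorne1977, II §5 p. 110 (f^*𝒪_Y = 𝒪_X)] -/
def pointUnitIso {Ω : Type u} [Field Ω] (t : Spec (.of Ω) ⟶ T) :
    (Scheme.Modules.pullback (A.baseChangeRestrict f t)).obj (SheafOfModules.unit (A.baseChange f).X.left.ringCatSheaf) ≅
      SheafOfModules.unit (A.baseChange (t ≫ f)).X.left.ringCatSheaf :=
  haveI := Literature.AlgebraicGeometry.KTheory.final_opensMap (A.baseChangeRestrict f t)
  haveI : IsIso (SheafOfModules.pullbackObjUnitToUnit (A.baseChangeRestrict f t).toRingCatSheafHom) :=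
    SheafOfModules.instIsIsoPullbackObjUnitToUnitOfFinal _
  asIso (SheafOfModules.pullbackObjUnitToUnit (A.baseChangeRestrict f t).toRingCatSheafHom)

variable [IsCommMonObj (A.baseChange f).X]

/-- **FIBRE EVALUATION OF THE PAIRING UNITS**: if `u_a ∈ Γ(T, 𝒪_T)` are the pairing units (★ W1b) of a trivialisation
`e : [M]^* L_{c_b} ≅ [M]^* 𝒪` for the translation action of `A_T[M](T)` on `A_T`, then at a geometric point `t` of `T`, for a
witness `Θ` of `λ` on the fibre `A_{t ≫ f}`, `ē^Θ_M(a(t), b(t)) = (u_a(t))⁻¹` ([MumfordAV1970] §20 p. 184, «`ē^L(x,y) = e_n(x, φ_L(y))`»,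
★ W3a read through ★ W1c `discrepancy_baseChange` along the square `A_{t ≫ f} → A_T`).
[cite: MumfordAV1970, §20 (p. 184) and §23 (p. 228)] [cite: Milne1986AbelianVarieties, §16 (p. 132)] -/
theorem weilPairingLevel_baseChangeTorsionPt_eq_inv [IsReduced S] [IsLocallyNoetherian S]
    {Ω : Type u} [Field Ω] (t : Spec (.of Ω) ⟶ T) (hM : (M : Ω) ≠ 0)
    (Θ : CartierDivisor (A.fibre (t ≫ f)).toAbelianVariety.X.left) (hΘ : A.IsLambdaOfAt (t ≫ f) D lam Θ)
    (b : (A.baseChange f).torsionSections M)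
    (e : (Scheme.Modules.pullback ((A.baseChange f).mulN M).left).obj
        (D.pullbackP f (A.torsionPointHat M f D lam b).left (Over.w _)) ≅
      (Scheme.Modules.pullback ((A.baseChange f).mulN M).left).obj (SheafOfModules.unit (A.baseChange f).X.left.ringCatSheaf))
    (u : (A.baseChange f).torsionSections M → Γ(T, ⊤))
    (hu : ∀ a : (A.baseChange f).torsionSections M,
      (Scheme.Modules.pullback (((A.baseChange f).translationActionMulN M).autHom a)).map e.hom ≫
        ((EquivariantStructure.ofPullback ((A.baseChange f).translationActionMulN M)
          (SheafOfModules.unit (A.baseChange f).X.left.ringCatSheaf)).iso a).hom =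
      ((EquivariantStructure.ofPullback ((A.baseChange f).translationActionMulN M)
          (D.pullbackP f (A.torsionPointHat M f D lam b).left (Over.w _))).iso a).hom ≫ e.hom ≫
        globalScalar _ (((A.baseChange f).mulN M).left.appTop ((A.baseChange f).X.hom.appTop (u a))))
    (a : (A.baseChange f).torsionSections M) :
    haveI := AbelianVariety.isDominant_toSchemeHom_zsmul_of_ne_zero (A.fibre (t ≫ f)).toAbelianVariety hM
    (A.fibre (t ≫ f)).toAbelianVariety.weilPairingLevel Θ (A.baseChangeTorsionPt M f t a) (A.baseChangeTorsionPt M f t b) =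
      ((Scheme.ΓSpecIso (.of Ω)).hom (t.appTop (u a)))⁻¹ := by
  haveI : IsCommMonObj (A.baseChange (t ≫ f)).X := A.isCommMonObj_pullback_obj (t ≫ f)
  have he' := TorsionPairing.discrepancy_baseChange t (A.baseChangeRestrict f t) (A.baseChangeRestrict_comp_hom f t)
    (A.baseChangeRestrict_comp_mulN_left M f t) ((A.baseChange f).translationActionMulN M) (A.pointTranslationAction M f t)
    (fun g => A.pointTranslationAction_autHom_comp_baseChangeRestrict M f t g)
    (D.pullbackP f (A.torsionPointHat M f D lam b).left (Over.w _)) (TorsionPairing.hasRank_pullbackP D f _) e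
    (D.pullbackP (t ≫ f) (A.valueAt (t ≫ f) D lam (A.baseChangeTorsionPt M f t b).1) (A.valueAt_comp_hom _ _ _ _))
    (A.pointLineBundleIso M f t D lam b) (A.pointUnitIso f t) u hu a
  exact A.weilPairingLevel_eq_inv_of_poincare_discrepancy D lam (t ≫ f) hΘ hM (A.baseChangeTorsionPt M f t a)
    (A.baseChangeTorsionPt M f t b) (A.pointTranslationAction M f t) a (A.pointTranslationAction_autHom_eq_translation M f t a)
    _ (t.appTop (u a)) he'

/-- In a field, an `M`-th root of unity has inverse its `(M-1)`-st power. [cite: MumfordAV1970, §20 (p. 184)] -/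
private theorem inv_eq_pow_pred' {F : Type u} [Field F] {z : F} {M : ℕ} [NeZero M] (hz : z ^ M = 1) : z⁻¹ = z ^ (M - 1) := by
  have hz0 : z ≠ 0 := by
    intro h
    rw [h, zero_pow (NeZero.ne M)] at hz
    exact zero_ne_one hz
  have h : z * z ^ (M - 1) = 1 := by
    rw [← pow_succ', Nat.sub_add_cancel (Nat.one_le_iff_ne_zero.2 (NeZero.ne M)), hz]
  exact (eq_inv_of_mul_eq_one_right h).symm

/-! ## §2 The transport -/

variable [IsMonHom lam]

/-- **THE GRAM DATA OF THE `M`-TORSION SECTIONS OF `A_T` IS THE SAME AT ALL GEOMETRIC POINTS OF A CONNECTED `T`** (up to a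
bijection of `M`-th roots of unity respecting powers): for `λ : A → Â` over a reduced locally Noetherian `S`, `f : T → S` with
`T` connected and `M` invertible on `T`, two geometric points `t₀, t₁` of `T` and witnesses `Θᵢ` of `λ` on the fibres
`A_{tᵢ ≫ f}` (`IsLambdaOfAt`), there is `χ : Ω₀ → Ω₁` carrying primitive `M`-th roots to primitive `M`-th roots, powers to powers,
and `ē^{Θ₀}_M(a(t₀), b(t₀))` to `ē^{Θ₁}_M(a(t₁), b(t₁))` for all `a, b ∈ A_T[M](T)` — both pairings are the inverse fibre values of
ONE unit `u_a ∈ Γ(T, 𝒪_T)^×` (★ W1b, `weilPairingLevel_baseChangeTorsionPt_eq_inv`), `M`-th roots of unity on a connected `T`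
are rigid (★ `RootOfUnityRigidConnected`), and the two evaluations of `μ_M(Γ(T, 𝒪_T))` extend to such a `χ` (★
`exists_rootsOfUnity_transport`).  [MumfordAV1970] §20 p. 184 (the `e_n`-pairing as a section of `μ_n` over the base) with
[Milne1986AbelianVarieties] §16 p. 132 (`ē_n` = `e_n ∘ (1 × φ_L)`).
[cite: MumfordAV1970, §20 (p. 184) and §23 (p. 228)] [cite: Milne1986AbelianVarieties, §16 (p. 132)] -/
theorem exists_rootsOfUnity_transport_weilPairingLevel {S T : Scheme.{u}} [IsReduced S] [IsLocallyNoetherian S]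
    [IsLocallyNoetherian T] [PreconnectedSpace T] (A : AbelianSchemeOver S) (D : A.DualPair)
    (hD : Nonempty ((Scheme.Modules.pullback (DualPair.unitHatSlice D)).obj D.P ≅ SheafOfModules.unit _))
    (lam : A.X ⟶ D.hat.X) [IsMonHom lam] (f : T ⟶ S) [IsCommMonObj (A.baseChange f).X] {M : ℕ} [NeZero M]
    (hMT : IsUnit (M : Γ(T, ⊤))) {Ω₀ Ω₁ : Type u} [Field Ω₀] [IsAlgClosed Ω₀] [Field Ω₁] [IsAlgClosed Ω₁]
    (t₀ : Spec (.of Ω₀) ⟶ T) (t₁ : Spec (.of Ω₁) ⟶ T) (hM₀ : (M : Ω₀) ≠ 0) (hM₁ : (M : Ω₁) ≠ 0)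
    (Θ₀ : CartierDivisor (A.fibre (t₀ ≫ f)).toAbelianVariety.X.left)
    (Θ₁ : CartierDivisor (A.fibre (t₁ ≫ f)).toAbelianVariety.X.left)
    (hΘ₀ : A.IsLambdaOfAt (t₀ ≫ f) D lam Θ₀) (hΘ₁ : A.IsLambdaOfAt (t₁ ≫ f) D lam Θ₁) :
    ∃ χ : Ω₀ → Ω₁, (∀ z, IsPrimitiveRoot z M → IsPrimitiveRoot (χ z) M) ∧
      (∀ z, z ^ M = 1 → ∀ e : ℕ, χ (z ^ e) = χ z ^ e) ∧
      ∀ a b : (A.baseChange f).torsionSections M,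
        haveI := AbelianVariety.isDominant_toSchemeHom_zsmul_of_ne_zero (A.fibre (t₀ ≫ f)).toAbelianVariety hM₀
        haveI := AbelianVariety.isDominant_toSchemeHom_zsmul_of_ne_zero (A.fibre (t₁ ≫ f)).toAbelianVariety hM₁
        χ ((A.fibre (t₀ ≫ f)).toAbelianVariety.weilPairingLevel Θ₀ (A.baseChangeTorsionPt M f t₀ a)
            (A.baseChangeTorsionPt M f t₀ b)) =
          (A.fibre (t₁ ≫ f)).toAbelianVariety.weilPairingLevel Θ₁ (A.baseChangeTorsionPt M f t₁ a)
            (A.baseChangeTorsionPt M f t₁ b) := by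
  classical
  -- the pairing units of `A_T[M](T)` acting on `L_{c_b}` over `[M]_{A_T}`, for every `b` (★ W1b §3 with `c := c_b`)
  have hex := fun b : (A.baseChange f).torsionSections M =>
    TorsionPairing.exists_poincarePairingUnit_fun D f hD (A.torsionPointHat M f D lam b)
      (A.torsionPointHat_pow_eq_one M f D lam b) ((A.baseChange f).translationActionMulN M)
  choose e u hu using hex
  -- every unit is an `M`-th root of unity
  have huM : ∀ a b, u b a ^ M = 1 := fun a b =>
    TorsionPairing.pairingUnit_pow_eq_one (A.baseChange f) ((A.baseChange f).translationActionMulN M) _ (e b) (u b) (hu b)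
      (Subtype.ext ((A.baseChange f).torsionSections_pow M a))
  -- the two evaluations `Γ(T, 𝒪_T) → Ωᵢ` and their rigidity on roots of unity
  let ev₀ : Γ(T, ⊤) →+* Ω₀ := (Scheme.ΓSpecIso (.of Ω₀)).hom.hom.comp t₀.appTop.hom
  let ev₁ : Γ(T, ⊤) →+* Ω₁ := (Scheme.ΓSpecIso (.of Ω₁)).hom.hom.comp t₁.appTop.hom
  have hev₀ : ∀ x, ev₀ x = (Scheme.ΓSpecIso (.of Ω₀)).hom (t₀.appTop x) := fun _ => rfl
  have hev₁ : ∀ x, ev₁ x = (Scheme.ΓSpecIso (.of Ω₁)).hom (t₁.appTop x) := fun _ => rfl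
  have hrig : ∀ {Ω : Type u} [Field Ω] (t : Spec (.of Ω) ⟶ T) (x : Γ(T, ⊤)), x ^ M = 1 →
      (Scheme.ΓSpecIso (.of Ω)).hom (t.appTop x) = 1 → x = 1 := by
    intro Ω _ t x hx h1
    refine eq_one_of_pow_eq_one_of_appTop_eq_one T x hMT hx t ?_
    have h2 : t.appTop x = (Scheme.ΓSpecIso (.of Ω)).inv ((Scheme.ΓSpecIso (.of Ω)).hom (t.appTop x)) := by
      rw [← CategoryTheory.comp_apply, Iso.hom_inv_id]; rfl
    rw [h2, h1, map_one]
  obtain ⟨χ, hprim, hpow, hχ⟩ := Literature.GroupTheory.FiniteAbelian.exists_rootsOfUnity_transport hM₀ hM₁ ev₀ ev₁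
    (fun x hx h1 => hrig t₀ x hx (by rw [← hev₀]; exact h1)) (fun x hx h1 => hrig t₁ x hx (by rw [← hev₁]; exact h1))
  refine ⟨χ, hprim, hpow, fun a b => ?_⟩
  -- both pairings are the inverse fibre values of the unit `u_b a`
  rw [A.weilPairingLevel_baseChangeTorsionPt_eq_inv M D lam f t₀ hM₀ Θ₀ hΘ₀ b (e b) (u b) (hu b) a,
    A.weilPairingLevel_baseChangeTorsionPt_eq_inv M D lam f t₁ hM₁ Θ₁ hΘ₁ b (e b) (u b) (hu b) a, ← hev₀, ← hev₁]
  have h0 : ev₀ (u b a) ^ M = 1 := by rw [← map_pow, huM, map_one]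
  have h1 : ev₁ (u b a) ^ M = 1 := by rw [← map_pow, huM, map_one]
  haveI : NeZero M := inferInstance
  rw [inv_eq_pow_pred' h0, inv_eq_pow_pred' h1, hpow _ h0, hχ _ (huM a b)]

end GramUnits

end Literature.AlgebraicGeometry.AbelianSchemes.AbelianSchemeOver

end
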